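import Summits.NavierStokesRegularity.NavierStokesRegularity.Theorems.PerpetualPumpAveragedTypeIBlowupPulseBootRegime
import Summits.NavierStokesRegularity.NavierStokesRegularity.Theorems.PerpetualPumpAveragedTypeIBlowupHandoffSlow
import Summits.NavierStokesRegularity.NavierStokesRegularity.Theorems.PerpetualPumpAveragedTypeIBlowupPreBootRegime
import Summits.NavierStokesRegularity.NavierStokesRegularity.Theorems.PerpetualPumpAveragedTypeIBlowupLevelOnePreTools
import Summits.NavierStokesRegularity.NavierStokesRegularity.Theorems.PerpetualPumpAveragedTypeIBlowupPulseTrunc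

/-!
# Crux `PerpetualPump.AveragedTypeIBlowup` (stmt-NavierStokesRegularity-1835), line `Sketch`:
# stub `pulseBoot` — the front triple during the truncated pulse

Second file of the proof of the registered stub `stub_pulseBoot`. In the slow time
`σ = R_n(s − tι)` from the first ignition, the front triple `(b_n, w_n, b_{n+1}/q)` of the critical
Toda system with memory errors is a FORCED TODA GATE `b' = −b − w² + f₁`,
`w' = w(b − β − 1) + f₂`, `β' = −q⁴β + w² + f₃` with `|fᵢ| ≤ 1/2000` under the loose induction
hypothesis, so the landed phase lemmas `stub_pulseEnvelope` and `stub_pulseLowerTrunc` give the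
tight front box; the Duhamel restart inequalities bound the front's majorants and integrating the
`β`-equation bounds the transfer `R_n ∫ w_n²` (`pulseBoot_front`). Registered tools sub-goal
`stub_pulseBootFront` (the initial datum `w = √b/10` at ignition).

## References

T. Tao, *Finite time blowup for an averaged three-dimensional Navier–Stokes equation*, J. Amer.
Math. Soc. 29 (2016), 601–674, §5–6 (the cascade / transfer-pulse heuristics); the content here is
folklore ODE calculus (comparison, Duhamel bounds, continuous induction).
-/

noncomputable section

-- the summit namespace `…NavierStokesRegularity.NavierStokesRegularity…` is the tree convention
set_option linter.dupNamespace false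

open Set MeasureTheory Filter Topology

namespace Summit.NavierStokesRegularity.NavierStokesRegularity.Theorems.PerpetualPumpAveragedTypeIBlowup

/-- **The front bond at ignition**: `w > 0` and `w² = b/100` give `w = √b/10`. [folklore] -/
theorem pulseBoot_w_ignition {w b : ℝ} (hw : 0 < w) (hig : w ^ 2 = b / 100) :
    w = Real.sqrt b / 10 := by
  have hb : 0 ≤ b := by nlinarith
  have h1 : Real.sqrt (w ^ 2) = w := Real.sqrt_sq hw.le
  rw [← h1, hig, Real.sqrt_div hb, show (100 : ℝ) = 10 ^ 2 by norm_num, Real.sqrt_sq (by norm_num)]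

set_option maxHeartbeats 1600000 in
/-- **The front triple on a truncated pulse horizon under the loose induction hypothesis.**
On `[tι, S]` (`R_n(S − tι) ≤ σ_P = (5 log B' + 20)/B'`, `B' = b_n(tι) ≥ 10⁴` the front carrier at
ignition, `w_n(tι)² = B'/100`, `w_n(tι) > 0`, `|b_{n+1}(tι)| ≤ ε̄ + q/100 + 10⁻³`): if the
neighbours and the front itself satisfy the LOOSE bounds (`|w_{n−1}| ≤ 1/100`, `|b_n|, |w_n| ≤
2(b_hi+4)`, `M0 n ≤ 6(b_hi+4)²`, `M1 n ≤ 10(b_hi+4)²`, `|b_{n+1}| ≤ 3(b_hi+4)`, `|w_{n+1}| ≤ 2Y₁ ≤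
1/100`, `M0 (n+1) ≤ 3B`), then in the slow time `σ = R_n(s − tι)` the triple
`(b_n, w_n, b_{n+1}/q)` is a forced Toda gate with forcings `≤ 1/2000`, so `stub_pulseEnvelope` and
`stub_pulseLowerTrunc` give the TIGHT front box `b_n ∈ [−1/2, B' + 1/100]`, `|w_n| ≤ B' + 1/100`,
`b_{n+1} ∈ [−q/50, q(B' + 1/100)]`; the Duhamel restart inequalities from `tι` bound the majorants
(`M0 n ≤ 3(b_hi+4)²`, `M1 n ≤ 5(b_hi+4)²`), and integrating `β' = −q⁴β + w² + f₃` bounds the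
transfer `R_n ∫_{tι}^s w_n² ≤ B' + 6 log B' + 23`. [folklore] -/
theorem pulseBoot_front {ε₀ D εb θ η F blo bhi q T t₀ tι S B Y₁ : ℝ} {n : ℤ}
    {bv wv M0 M1 db dw G0 G1 : ℤ → ℝ → ℝ} {R : ℤ → ℝ}
    (hq : q = Real.sqrt (1 + ε₀)) (hR : ∀ k : ℤ, R k = D * (1 + ε₀) ^ (2 * k))
    (hG0 : ∀ (k : ℤ) (t : ℝ), G0 k t = (wv (k - 1) t) ^ 2 / q ^ 3 - (wv k t) ^ 2 - εb * bv k t * wv k t)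
    (hG1 : ∀ (k : ℤ) (t : ℝ), G1 k t = wv k t * (bv k t - bv (k + 1) t / q) + εb * (bv k t) ^ 2)
    (hε₀ : 0 < ε₀) (hε₀' : ε₀ ≤ 1 / 20) (hD : 0 < D) (hθ : 1 / 2 ≤ θ) (hη : 0 ≤ η)
    (hεb : 0 < εb) (hεb6 : εb ≤ 1 / 10 ^ 6) (hblo : 10 ^ 4 + 40 - 5 * Real.log εb ≤ blo)
    (hF : 10 ^ 9 * (bhi + 4) ^ 4 ≤ F) (hηreg : η * (10 ^ 9 * (bhi + 4) ^ 4 * (F + 1)) ≤ 1)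
    (hεbreg : εb * (10 ^ 9 * (F + 1) ^ 2 * (bhi + 4) ^ 3) ≤ 1) (hBlo : blo ≤ B) (hBhi : B ≤ bhi)
    (hcont : ∀ k : ℤ, ContinuousOn (bv k) (Icc 0 T) ∧ ContinuousOn (wv k) (Icc 0 T) ∧
      ContinuousOn (M0 k) (Icc 0 T) ∧ ContinuousOn (M1 k) (Icc 0 T))
    (hC1 : ∀ k : ℤ, ContinuousOn (db k) (Icc 0 T) ∧ ContinuousOn (dw k) (Icc 0 T) ∧
      ∀ t ∈ Ioo 0 T, HasDerivAt (bv k) (db k t) t ∧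
        |db k t - R k * (-(bv k t) + G0 k t)| ≤ η * R k * M0 k t ∧
        HasDerivAt (wv k) (dw k t) t ∧ |dw k t - R k * (-(wv k t) + G1 k t)| ≤ η * R k * M1 k t)
    (hmaj : ∀ k : ℤ, ∀ t ∈ Icc 0 T, |bv k t| ≤ M0 k t ∧ |wv k t| ≤ M1 k t ∧ 0 ≤ M0 k t ∧ 0 ≤ M1 k t)
    (hrest : ∀ k : ℤ, ∀ t₁ ∈ Icc 0 T, ∀ t₂ ∈ Icc t₁ T,
      M0 k t₂ ≤ M0 k t₁ * Real.exp (-(θ * R k * (t₂ - t₁))) +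
          R k * ∫ u in t₁..t₂, Real.exp (-(θ * R k * (t₂ - u))) * |G0 k u| ∧
        M1 k t₂ ≤ M1 k t₁ * Real.exp (-(θ * R k * (t₂ - t₁))) +
          R k * ∫ u in t₁..t₂, Real.exp (-(θ * R k * (t₂ - u))) * |G1 k u|)
    (hT : 0 < T) (ht₀ : 0 ≤ t₀) (htι : t₀ < tι) (hS : tι ≤ S) (hST : S ≤ T)
    (hSP : S ≤ tι + (5 * Real.log (bv n tι) + 20) / bv n tι / R n)
    (hB' : 10 ^ 4 ≤ bv n tι) (hB'B : bv n tι ≤ B + 5 / 2)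
    (hw0 : 0 < wv n tι) (hig : (wv n tι) ^ 2 = bv n tι / 100)
    (hb10 : |bv (n + 1) tι| ≤ εb + q / 100 + 1 / 10 ^ 3) (hM0ι : M0 n tι ≤ 6 * (B + 3))
    (hM1ι : M1 n tι ≤ F * εb * B + 2 * wv n tι + 2 * εb * (B + 3) ^ 2 * 3)
    (hY' : 2 * Y₁ ≤ 1 / 100)
    (hL : ∀ u ∈ Icc tι S, |wv (n - 1) u| ≤ 1 / 100 ∧ |bv n u| ≤ 2 * (bhi + 4) ∧
      |wv n u| ≤ 2 * (bhi + 4) ∧ M0 n u ≤ 6 * (bhi + 4) ^ 2 ∧ M1 n u ≤ 10 * (bhi + 4) ^ 2 ∧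
      |bv (n + 1) u| ≤ 3 * (bhi + 4) ∧ |wv (n + 1) u| ≤ 2 * Y₁ ∧ M0 (n + 1) u ≤ 3 * B) :
    ∀ u ∈ Icc tι S, -(1 / 2) ≤ bv n u ∧ bv n u ≤ bv n tι + 1 / 100 ∧
      |wv n u| ≤ bv n tι + 1 / 100 ∧ -(q / 50) ≤ bv (n + 1) u ∧
      bv (n + 1) u ≤ q * (bv n tι + 1 / 100) ∧
      M0 n u ≤ 3 * (bhi + 4) ^ 2 ∧ M1 n u ≤ 5 * (bhi + 4) ^ 2 ∧
      R n * ∫ t in tι..u, (wv n t) ^ 2 ≤ bv n tι + 6 * Real.log (bv n tι) + 23 := by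
  obtain ⟨hεb1, hB4, hB1, hF0, hFεB, -, hq1, hq21⟩ :=
    oneStepCore_regime hε₀ hε₀' hεb hεb6 hblo hF hεbreg hBlo hBhi hq
  have hbhi : 1 ≤ bhi + 4 := by linarith
  obtain ⟨-, hεb2, hq4lo, hq4hi, hq3lo, hq3hi, -, hq0, -, -⟩ :=
    pulseBoot_sizes hε₀ hε₀' hεb hF0 hbhi hεbreg hq
  obtain ⟨hRpos, hRkk, -, hκ4, -, -, -, -, -, -, -⟩ := preBoot_rates hε₀ hε₀' hD hR hq n
  have hRn := hRpos n
  have hθ0 : 0 < θ := by linarith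
  obtain ⟨hη9, hη1, hη2, -⟩ := preBoot_eta hη hF0 hbhi hηreg
  set B' := bv n tι with hB'def
  have hB'0 : 0 < B' := by linarith
  -- slow time of the front from the ignition time
  set S' := R n * (S - tι) with hS'
  have hS'0 : 0 ≤ S' := mul_nonneg hRn.le (by linarith)
  obtain ⟨hlog0, -, hσP0, hσP⟩ := pulseBoot_sigmaP hB'
  have hS'P : S' ≤ (5 * Real.log B' + 20) / B' := by
    have h1 : S - tι ≤ (5 * Real.log B' + 20) / B' / R n := by linarith
    calc S' = R n * (S - tι) := rfl
      _ ≤ R n * ((5 * Real.log B' + 20) / B' / R n) := mul_le_mul_of_nonneg_left h1 hRn.le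
      _ = (5 * Real.log B' + 20) / B' := mul_div_cancel₀ _ hRn.ne'
  have hS'le : S' ≤ 1 / 10 := hS'P.trans hσP
  have hST' : tι + S' / R n ≤ T := by
    rw [hS', mul_div_cancel_left₀ _ hRn.ne']
    linarith
  have htι0 : 0 ≤ tι := by linarith
  obtain ⟨⟨hbc, hm0c, hg0c, he0c, hdb, he0, hm0D⟩, ⟨hwc, hm1c, hg1c, he1c, hdw, he1, hm1D⟩⟩ :=
    handoff_sysPkg (k := n) hG0 hG1 hcont hC1 hmaj hrest hRn hT htι0 hS'0 hST'
  obtain ⟨⟨hb1c, -, hg01c, he01c, hdb1, he01, -⟩, -⟩ :=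
    handoff_sysPkg (k := n + 1) hG0 hG1 hcont hC1 hmaj hrest hRn hT htι0 hS'0 hST'
  -- clock algebra of the slow time from `tι`
  have hmem : ∀ σ ∈ Icc 0 S', tι + σ / R n ∈ Icc tι S := by
    intro σ hσ
    have h0 : 0 ≤ σ / R n := div_nonneg hσ.1 hRn.le
    have h1 : σ / R n ≤ S' / R n := div_le_div_of_nonneg_right hσ.2 hRn.le
    rw [hS', mul_div_cancel_left₀ _ hRn.ne'] at h1
    exact ⟨by linarith, by linarith⟩
  have htime1 : ∀ s : ℝ, tι + R n * (s - tι) / R n = s := fun s => by field_simp; ring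
  have htime : ∀ σ : ℝ, R n * ((tι + σ / R n) - tι) = σ := fun σ => by field_simp; ring
  have ht00 : tι + 0 / R n = tι := by simp
  have hn1 : n + 1 - 1 = n := by ring
  -- the loose bounds in slow time
  have hLσ : ∀ σ ∈ Icc 0 S', |wv (n - 1) (tι + σ / R n)| ≤ 1 / 100 ∧
      |bv n (tι + σ / R n)| ≤ 2 * (bhi + 4) ∧ |wv n (tι + σ / R n)| ≤ 2 * (bhi + 4) ∧
      M0 n (tι + σ / R n) ≤ 6 * (bhi + 4) ^ 2 ∧ M1 n (tι + σ / R n) ≤ 10 * (bhi + 4) ^ 2 ∧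
      |bv (n + 1) (tι + σ / R n)| ≤ 3 * (bhi + 4) ∧ |wv (n + 1) (tι + σ / R n)| ≤ 2 * Y₁ ∧
      M0 (n + 1) (tι + σ / R n) ≤ 3 * B := fun σ hσ => hL _ (hmem σ hσ)
  -- the gate structure: derivatives
  have hbd : ∀ σ ∈ Ioo 0 S', HasDerivAt (fun s => bv n (tι + s / R n))
      (-(bv n (tι + σ / R n)) - (wv n (tι + σ / R n)) ^ 2 +
        ((wv (n - 1) (tι + σ / R n)) ^ 2 / q ^ 3 -
            εb * bv n (tι + σ / R n) * wv n (tι + σ / R n) +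
          (db n (tι + σ / R n) - R n * (-(bv n (tι + σ / R n)) + G0 n (tι + σ / R n))) / R n)) σ := by
    intro σ hσ
    refine (hdb σ hσ).congr_deriv ?_
    rw [hRkk, hG0]
    ring
  have hwd : ∀ σ ∈ Ioo 0 S', HasDerivAt (fun s => wv n (tι + s / R n))
      (wv n (tι + σ / R n) * (bv n (tι + σ / R n) - bv (n + 1) (tι + σ / R n) / q - 1) +
        (εb * (bv n (tι + σ / R n)) ^ 2 +
          (dw n (tι + σ / R n) - R n * (-(wv n (tι + σ / R n)) + G1 n (tι + σ / R n))) / R n)) σ := by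
    intro σ hσ
    refine (hdw σ hσ).congr_deriv ?_
    rw [hRkk, hG1]
    ring
  have hβd : ∀ σ ∈ Ioo 0 S', HasDerivAt (fun s => bv (n + 1) (tι + s / R n) / q)
      (-(q ^ 4 * (bv (n + 1) (tι + σ / R n) / q)) + (wv n (tι + σ / R n)) ^ 2 +
        (-(q ^ 3 * ((wv (n + 1) (tι + σ / R n)) ^ 2 +
            εb * bv (n + 1) (tι + σ / R n) * wv (n + 1) (tι + σ / R n))) +
          (db (n + 1) (tι + σ / R n) -
            R (n + 1) * (-(bv (n + 1) (tι + σ / R n)) + G0 (n + 1) (tι + σ / R n))) / R n / q)) σ := by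
    intro σ hσ
    refine ((hdb1 σ hσ).div_const q).congr_deriv ?_
    rw [hκ4, hG0, hn1]
    field_simp
    ring
  -- the gate structure: sizes of the forcings
  have hf : ∀ σ ∈ Icc 0 S',
      |(wv (n - 1) (tι + σ / R n)) ^ 2 / q ^ 3 -
            εb * bv n (tι + σ / R n) * wv n (tι + σ / R n) +
          (db n (tι + σ / R n) - R n * (-(bv n (tι + σ / R n)) + G0 n (tι + σ / R n))) / R n| ≤
        1 / 2000 ∧
      |εb * (bv n (tι + σ / R n)) ^ 2 +
          (dw n (tι + σ / R n) - R n * (-(wv n (tι + σ / R n)) + G1 n (tι + σ / R n))) / R n| ≤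
        1 / 2000 ∧
      |-(q ^ 3 * ((wv (n + 1) (tι + σ / R n)) ^ 2 +
            εb * bv (n + 1) (tι + σ / R n) * wv (n + 1) (tι + σ / R n))) +
          (db (n + 1) (tι + σ / R n) -
            R (n + 1) * (-(bv (n + 1) (tι + σ / R n)) + G0 (n + 1) (tι + σ / R n))) / R n / q| ≤
        1 / 2000 := by
    intro σ hσ
    obtain ⟨l1, l2, l3, l4, l5, l6, l7, l8⟩ := hLσ σ hσ
    have e0b := he0 σ hσ
    have e1b := he1 σ hσ
    have e01b := he01 σ hσ
    rw [hRkk] at e0b e1b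
    rw [hκ4] at e01b
    exact pulseBoot_front_forcings hεb hη hεb2 hη1 hη2 hbhi hBhi (by linarith) hq0 hq1 hq3lo hq3hi hq4hi
      hY' l1 l2 l3 l4 l5 l6 l7 l8 e0b e1b e01b
  -- the initial data at ignition
  have hb0 : bv n (tι + 0 / R n) = B' := by rw [ht00]
  have hwι : wv n tι = Real.sqrt B' / 10 := pulseBoot_w_ignition hw0 hig
  have hw0' : wv n (tι + 0 / R n) = Real.sqrt B' / 10 := by rw [ht00, hwι]
  have hβ0 : |bv (n + 1) (tι + 0 / R n) / q| ≤ 1 / 50 := by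
    rw [ht00, abs_div, abs_of_pos hq0]
    refine (div_le_self (abs_nonneg _) hq1).trans (hb10.trans ?_)
    linarith
  -- the phase lemmas
  have key := stub_pulseEnvelope (fun s => bv n (tι + s / R n)) (fun s => wv n (tι + s / R n))
    (fun s => bv (n + 1) (tι + s / R n) / q)
    (fun σ => (wv (n - 1) (tι + σ / R n)) ^ 2 / q ^ 3 -
        εb * bv n (tι + σ / R n) * wv n (tι + σ / R n) +
      (db n (tι + σ / R n) - R n * (-(bv n (tι + σ / R n)) + G0 n (tι + σ / R n))) / R n)
    (fun σ => εb * (bv n (tι + σ / R n)) ^ 2 +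
      (dw n (tι + σ / R n) - R n * (-(wv n (tι + σ / R n)) + G1 n (tι + σ / R n))) / R n)
    (fun σ => -(q ^ 3 * ((wv (n + 1) (tι + σ / R n)) ^ 2 +
        εb * bv (n + 1) (tι + σ / R n) * wv (n + 1) (tι + σ / R n))) +
      (db (n + 1) (tι + σ / R n) -
        R (n + 1) * (-(bv (n + 1) (tι + σ / R n)) + G0 (n + 1) (tι + σ / R n))) / R n / q)
    B' (q ^ 4) (1 / 2000) S' hB' hq4lo hq4hi (by norm_num) le_rfl hS'le hbc hwc (hb1c.div_const q)
    hbd hwd hβd hf hb0 hw0' hβ0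
  have keyL := stub_pulseLowerTrunc (fun s => bv n (tι + s / R n)) (fun s => wv n (tι + s / R n))
    (fun s => bv (n + 1) (tι + s / R n) / q)
    (fun σ => (wv (n - 1) (tι + σ / R n)) ^ 2 / q ^ 3 -
        εb * bv n (tι + σ / R n) * wv n (tι + σ / R n) +
      (db n (tι + σ / R n) - R n * (-(bv n (tι + σ / R n)) + G0 n (tι + σ / R n))) / R n)
    (fun σ => εb * (bv n (tι + σ / R n)) ^ 2 +
      (dw n (tι + σ / R n) - R n * (-(wv n (tι + σ / R n)) + G1 n (tι + σ / R n))) / R n)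
    (fun σ => -(q ^ 3 * ((wv (n + 1) (tι + σ / R n)) ^ 2 +
        εb * bv (n + 1) (tι + σ / R n) * wv (n + 1) (tι + σ / R n))) +
      (db (n + 1) (tι + σ / R n) -
        R (n + 1) * (-(bv (n + 1) (tι + σ / R n)) + G0 (n + 1) (tι + σ / R n))) / R n / q)
    B' (q ^ 4) (1 / 2000) S' hB' hq4lo hq4hi (by norm_num) le_rfl hS'le hbc hwc (hb1c.div_const q)
    hbd hwd hβd hf hb0 hw0' hβ0
  -- the tight front box in slow time
  have hfrσ : ∀ σ ∈ Icc 0 S', -(1 / 2) ≤ bv n (tι + σ / R n) ∧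
      bv n (tι + σ / R n) ≤ B' + 1 / 100 ∧ |bv n (tι + σ / R n)| ≤ B' + 1 / 100 ∧
      |wv n (tι + σ / R n)| ≤ B' + 1 / 100 ∧ -(1 / 50) ≤ bv (n + 1) (tι + σ / R n) / q ∧
      |bv (n + 1) (tι + σ / R n) / q| ≤ B' + 1 / 100 := fun σ hσ => by
    obtain ⟨k1, k2, k3, k4, -, -⟩ := key σ hσ
    exact ⟨keyL σ hσ, (abs_le.1 k1).2, k1, k2, k4, k3⟩
  -- the transfer budget: `∫ w² = β(σ) − β(0) + ∫ (q⁴β − f₃)`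
  have hDc : ContinuousOn (fun v => -(q ^ 4 * (bv (n + 1) (tι + v / R n) / q)) +
      (wv n (tι + v / R n)) ^ 2 +
      (-(q ^ 3 * ((wv (n + 1) (tι + v / R n)) ^ 2 +
          εb * bv (n + 1) (tι + v / R n) * wv (n + 1) (tι + v / R n))) +
        (db (n + 1) (tι + v / R n) -
          R (n + 1) * (-(bv (n + 1) (tι + v / R n)) + G0 (n + 1) (tι + v / R n))) / R n / q))
      (Icc 0 S') := by
    have h : ContinuousOn (fun v => (R (n + 1) / R n * (-(bv (n + 1) (tι + v / R n)) +
        G0 (n + 1) (tι + v / R n)) + (db (n + 1) (tι + v / R n) -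
          R (n + 1) * (-(bv (n + 1) (tι + v / R n)) + G0 (n + 1) (tι + v / R n))) / R n) / q)
        (Icc 0 S') := ((continuousOn_const.mul (hb1c.neg.add hg01c)).add he01c).div_const q
    refine h.congr fun v _ => ?_
    beta_reduce
    rw [hκ4, hG0, hn1]
    field_simp
    ring
  have hbudσ : ∀ σ ∈ Icc 0 S', ∫ v in (0 : ℝ)..σ, (wv n (tι + v / R n)) ^ 2 ≤
      B' + 6 * Real.log B' + 23 := by
    intro σ hσ
    have hsub : Icc 0 σ ⊆ Icc 0 S' := Icc_subset_Icc_right hσ.2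
    have hFTC := intervalIntegral.integral_eq_sub_of_hasDerivAt_of_le hσ.1
      ((hb1c.div_const q).mono hsub) (fun v hv => hβd v ⟨hv.1, hv.2.trans_le hσ.2⟩)
      ((hDc.mono hsub).intervalIntegrable_of_Icc hσ.1)
    set C := q ^ 4 * (B' + 1 / 100) + 1 / 2000 with hC
    have hiD := (hDc.mono hsub).intervalIntegrable_of_Icc (μ := volume) hσ.1
    have hiC : IntervalIntegrable (fun _ => C) volume 0 σ := intervalIntegrable_const
    have hmono : ∫ v in (0 : ℝ)..σ, (wv n (tι + v / R n)) ^ 2 ≤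
        ∫ v in (0 : ℝ)..σ, ((-(q ^ 4 * (bv (n + 1) (tι + v / R n) / q)) +
          (wv n (tι + v / R n)) ^ 2 +
          (-(q ^ 3 * ((wv (n + 1) (tι + v / R n)) ^ 2 +
              εb * bv (n + 1) (tι + v / R n) * wv (n + 1) (tι + v / R n))) +
            (db (n + 1) (tι + v / R n) -
              R (n + 1) * (-(bv (n + 1) (tι + v / R n)) + G0 (n + 1) (tι + v / R n))) / R n / q)) +
          C) :=
      intervalIntegral.integral_mono_on hσ.1 (((hwc.pow 2).mono hsub).intervalIntegrable_of_Icc hσ.1)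
        (hiD.add hiC) fun v hv => by
          have hv' : v ∈ Icc 0 S' := hsub hv
          obtain ⟨-, -, -, -, -, k6⟩ := hfrσ v hv'
          have hβle := (abs_le.1 k6).2
          obtain ⟨-, -, f3b⟩ := hf v hv'
          have f3l := (abs_le.1 f3b).1
          have : q ^ 4 * (bv (n + 1) (tι + v / R n) / q) ≤ q ^ 4 * (B' + 1 / 100) :=
            mul_le_mul_of_nonneg_left hβle (by positivity)
          rw [hC]
          linarith
    rw [intervalIntegral.integral_add hiD hiC, hFTC, intervalIntegral.integral_const, smul_eq_mul,
      sub_zero] at hmono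
    have hβσ := (abs_le.1 (hfrσ σ hσ).2.2.2.2.2).2
    have hβ0' : -(1 / 50) ≤ bv (n + 1) (tι + 0 / R n) / q := (hfrσ 0 ⟨le_rfl, hS'0⟩).2.2.2.2.1
    -- `C σ ≤ 1.111 (5 log B' + 20)`
    have hC0 : 0 ≤ C := by rw [hC]; positivity
    have hCB : C ≤ 1111 / 1000 * B' := by
      have : q ^ 4 * (B' + 1 / 100) ≤ 111 / 100 * (B' + 1 / 100) :=
        mul_le_mul_of_nonneg_right hq4hi (by linarith)
      rw [hC]
      linarith
    have hCσ : σ * C ≤ 1111 / 1000 * (5 * Real.log B' + 20) := by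
      have h1 : σ * C ≤ (5 * Real.log B' + 20) / B' * C :=
        mul_le_mul_of_nonneg_right (hσ.2.trans hS'P) hC0
      have h2 : (5 * Real.log B' + 20) / B' * C = (5 * Real.log B' + 20) * (C / B') := by ring
      have h3 : C / B' ≤ 1111 / 1000 := by rw [div_le_iff₀ hB'0]; linarith
      have h4 : (5 * Real.log B' + 20) * (C / B') ≤ (5 * Real.log B' + 20) * (1111 / 1000) :=
        mul_le_mul_of_nonneg_left h3 (by linarith)
      linarith
    linarith
  -- the majorants from the Duhamel restart inequalities
  have hMσ : ∀ σ ∈ Icc 0 S', M0 n (tι + σ / R n) ≤ 3 * (bhi + 4) ^ 2 ∧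
      M1 n (tι + σ / R n) ≤ 5 * (bhi + 4) ^ 2 := by
    intro σ hσ
    have hsub : Icc 0 σ ⊆ Icc 0 S' := Icc_subset_Icc_right hσ.2
    have hbnd : ∀ v ∈ Icc 0 σ, |G0 n (tι + v / R n)| ≤ (bhi + 3) ^ 2 ∧
        |G1 n (tι + v / R n)| ≤ 2 * (bhi + 13 / 5) ^ 2 := by
      intro v hv
      have hv' := hsub hv
      obtain ⟨-, -, k3, k4, -, k6⟩ := hfrσ v hv'
      obtain ⟨l1, -⟩ := hLσ v hv'
      rw [hG0, hG1]
      exact pulseBoot_front_brackets hεb hεb2 hq1 (by linarith) k3 k4 k6 l1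
    have hκ1 : R n / R n = 1 := hRkk n
    have hθκ : 0 < θ * (R n / R n) := by rw [hκ1, mul_one]; exact hθ0
    have hL1 : 0 ≤ R n / R n := by rw [hκ1]; exact zero_le_one
    have hC0 : (0 : ℝ) ≤ (bhi + 3) ^ 2 := sq_nonneg _
    have hC1 : (0 : ℝ) ≤ 2 * (bhi + 13 / 5) ^ 2 := by positivity
    have m0 := levelOnePre_majorant hθκ hC0 hL1 hσ.1 (hg0c.mono hsub) (fun v hv => (hbnd v hv).1)
      (hm0D σ hσ).2
    have m1 := levelOnePre_majorant hθκ hC1 hL1 hσ.1 (hg1c.mono hsub) (fun v hv => (hbnd v hv).2)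
      (hm1D σ hσ).2
    rw [ht00, hκ1, mul_one, one_mul] at m0 m1
    have hex : Real.exp (-(θ * σ)) ≤ 1 :=
      Real.exp_le_one_iff.2 (by have := mul_nonneg hθ0.le hσ.1; linarith)
    obtain ⟨-, -, hM0nn, hM1nn⟩ := hmaj n tι ⟨htι0, by linarith⟩
    have hM0e := mul_le_of_le_one_right hM0nn hex
    have hM1e := mul_le_of_le_one_right hM1nn hex
    have hd0 : (bhi + 3) ^ 2 / θ ≤ 2 * (bhi + 3) ^ 2 := by
      rw [div_le_iff₀ hθ0]
      have := mul_le_mul_of_nonneg_left hθ hC0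
      linarith only [this]
    have hd1 : 2 * (bhi + 13 / 5) ^ 2 / θ ≤ 4 * (bhi + 13 / 5) ^ 2 := by
      rw [div_le_iff₀ hθ0]
      have := mul_le_mul_of_nonneg_left hθ hC1
      linarith only [this]
    -- the initial majorants at ignition
    have hsq : Real.sqrt B' ≤ B' := by
      rw [Real.sqrt_le_left hB'0.le]
      exact le_self_pow₀ (by linarith only [hB']) two_ne_zero
    have hεB3 : εb * (B + 3) ^ 2 ≤ 1 / 10 ^ 9 := by
      have : εb * (B + 3) ^ 2 ≤ εb * (bhi + 4) ^ 2 :=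
        mul_le_mul_of_nonneg_left (pow_le_pow_left₀ (by linarith) (by linarith) 2) hεb.le
      linarith
    have hM1ι' : M1 n tι ≤ 11 / 10 + B' / 5 := by rw [hwι] at hM1ι; linarith
    have e3 : (bhi + 3) ^ 2 = bhi ^ 2 + 6 * bhi + 9 := by ring
    have e4 : (bhi + 4) ^ 2 = bhi ^ 2 + 8 * bhi + 16 := by ring
    have e5 : (bhi + 13 / 5) ^ 2 = bhi ^ 2 + 26 / 5 * bhi + 169 / 25 := by ring
    have hb2 : 0 ≤ bhi ^ 2 := sq_nonneg _
    rw [e3] at hd0 m0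
    rw [e5] at hd1 m1
    rw [e4]
    constructor
    · linarith
    · linarith
  -- back to real time
  intro u hu
  have hσu : R n * (u - tι) ∈ Icc 0 S' :=
    ⟨mul_nonneg hRn.le (by linarith [hu.1]), mul_le_mul_of_nonneg_left (by linarith [hu.2]) hRn.le⟩
  have hut : tι + R n * (u - tι) / R n = u := htime1 u
  obtain ⟨a1, a2, -, a4, a5, a6⟩ := hfrσ _ hσu
  obtain ⟨m0, m1⟩ := hMσ _ hσu
  have hb' := hbudσ _ hσu
  rw [hut] at a1 a2 a4 a5 a6 m0 m1
  have a6' := (abs_le.1 a6).2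
  refine ⟨a1, a2, a4, ?_, ?_, m0, m1, ?_⟩
  · rw [le_div_iff₀ hq0] at a5
    linarith
  · rw [div_le_iff₀ hq0] at a6'
    linarith
  · have e1 : ∫ v in (0 : ℝ)..R n * (u - tι), (wv n (tι + v / R n)) ^ 2 =
        R n * ∫ t in tι..u, (wv n t) ^ 2 := by
      rw [← integral_rescale (fun t => (wv n t) ^ 2) hRn.ne' 0 (R n * (u - tι)),
        intervalIntegral.integral_const_mul, ht00, hut]
    rw [e1] at hb'
    exact hb'


/-- **Registered tools sub-goal `stub_pulseBootFront`** of the stub `pulseBoot` (line `Sketch`,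
crux stmt-NavierStokesRegularity-1835): the front bond at ignition, `w > 0`, `w² = b/100` give
`w = √b/10` (`pulseBoot_w_ignition`, the initial datum of the pulse lemmas). [folklore] -/
theorem stub_pulseBootFront :
    ∀ w b : ℝ, 0 < w → w ^ 2 = b / 100 → w = Real.sqrt b / 10 :=
  fun _ _ hw hig => pulseBoot_w_ignition hw hig

end Summit.NavierStokesRegularity.NavierStokesRegularity.Theorems.PerpetualPumpAveragedTypeIBlowup

end
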